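import Summits.Ventures.CertifiedArithmetic.LowPrec.GemmFirstRegimeLawAll
import HarnessLib

/-!
# GEMM worst case LXV — THE FIRST-REGIME LAW UNDER `Q ≥ m₀ + 2` (file LXIV-c needed `Q ≥ M + 2`),
# AND THE bfloat16 LAW `W_8(n) = max((n-2)/(286+n), (n-3)/(253+n))` FOR EVERY `3 ≤ n ≤ 130`

HONEST FRAMING: certified error envelopes and provably optimal rounding/accumulation schemes for
low-precision formats under stated cost models; every table by two implementations; no hardware or
vendor claims.

Setting of files LXII-a … LXIV-c (grid alphabet `x j = z_j/2^G`, `|z_j| ≤ M`, odd only when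
`|z_j| ≤ m₀`; `T = 2^(manBits+1)`; exact prefix `M j₀ + m₀ < T`; `M(j₀+2) + Q = 2T`; entry-mass
hypothesis `H_B`).  File LXIV-c proved `R(x, j₀+1+d) ≤ max((d+1)/(B+d+1), d/(T+d))` on the whole
first regime `d + 1 ≤ T/2` under `Q ≥ M + 2` — met by every binary32 row, NOT by the bfloat16 row
of E2M1² (`M = 144`, `j₀ = 1`, `Q = 512 - 432 = 80 < 146`), whose exact law was therefore only a
two-sided sandwich in the kernel (`worstP_BFloat16_firstRegime`, file LX).

THEOREM (`relErr_le_firstRegimeLaw_allQ`, gemm.tex Prop. p:fpL (iv)): the same conclusion under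
`Q ≥ m₀ + 2` only (bfloat16: `80 ≥ 11`).  In file LXIV-c the hypothesis `Q ≥ M + 2` served at ONE
place: to put the second argument after the exact prefix below `2T` (hypothesis `hV1` of the spine
theorem `spineZ_abs`).  THE NEW CASE, second argument at or above `2T`: then the entry step was
EXACT.  The entry argument is `V = s_{j₀+1}` in grid units (`KZ_shapeG`): either an odd letter was
used and `|V| ≤ M(j₀+1) + m₀`, whence (`|RNE(V) - V| ≤ 1`, `rneZ_err_le`) the second argument is
at most `M(j₀+2) + m₀ + 1 = 2T - Q + m₀ + 1 < 2T` — excluded; or `V` is even with `|V| ≤ M(j₀+2)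
< 2T`, and integer RNE to `manBits + 1` bits fixes every even integer below `2T` (`rneZ_level`,
ties to even not even needed: the candidates are the even neighbours).  So `ŝ_{j₀+1} = s_{j₀+1}`
(bridge `toRat_seqSum_eq_accZ` of file LXIV-c), the rest of the word is a recursive summation of
`d + 1` values of `φ` started at an exact accumulator, and Lange–Rump in the restart form of file
LXIII-b with zero entry error (`relErr_le_langeRump_exact`) gives `R ≤ d/(T+d)`.  Every other word:
file LXIV-c verbatim (low words `lowInvG_of_low`/`relErr_le_of_lowInvG`; high words the bridge and
`spineZ_abs`).

ROWS: `gridW_le_firstRegimeLaw_allQ`; E2M1² in EVERY precision `p ≥ 8` (`worstP_le_firstRegimeLaw_allQ`,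
`Q ≥ 11`); the exact law for `p ≡ 2 (mod 6)`, `p ≥ 8` (`worstP_firstRegimeLaw_two_allQ`; file
LXIV-c: `p ≥ 14`); its instance bfloat16 (`p = 8`, `T = 256 = 144 + 112`, `n₀ = 2`),
`worstP_BFloat16_law`: `W_8(1+k) = max(k/(288+k), (k-1)/(255+k))` for EVERY `1 ≤ k ≤ 128` — the
exact worst-case relative error of `n = k + 2 ∈ [3, 130]` FP4 products accumulated sequentially in
bfloat16 (the certificate by two implementations, gemm.tex Prop. p:bf16law, agrees and extends to
`n = 131`).  References: [Higham2002, §4.2], [IEEE7542019, §4.3.1], [LangeRump2019],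
[BoldoEtAl2023, Thm 4.5], [BlanchardHighamLopezMaryPranesh2020, Table 1.1], [RouhaniEtAl2023MX].
-/

namespace Summit.Ventures.CertifiedArithmetic.LowPrec.Gemm

open Literature.ComputerArithmetic.FloatingPoint
open Literature.ComputerArithmetic.FloatingPoint.MiniFloat
open Literature.ComputerArithmetic.JeannerodRump2018
open Finset

variable {φ : Format}

section Grid

variable {G M m0 E : ℕ} {x : ℕ → ℚ}
  (hx : ∀ j, ∃ z : ℤ, x j = (z : ℚ) / 2 ^ G ∧ z.natAbs ≤ M ∧ (z % 2 = 0 ∨ z.natAbs ≤ m0))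
  (hq : φ.qexp ≤ -(G : ℤ)) (hR : (2 : ℚ) ^ (φ.manBits + E + 3) ≤ φ.maxRat)
  (hm0M : m0 ≤ M) (hMT : M ≤ 2 ^ (φ.manBits + 1)) (hm0 : 1 ≤ m0) (hME : M ≤ 2 ^ (G + E))
include hx hq hR hm0M hMT hm0 hME

omit hm0M hm0 in
/-- LANGE–RUMP FROM AN EXACT ACCUMULATOR: `ŝ_a = s_a` with `|ŝ_a| ≤ 2T/2^G`, then `r ≤ T/2` more
recursive additions of letters: `R(x, a + r) ≤ r/(T + r)` (`= ru/(1+ru)`) — the restarted word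
`ŝ_a, x_{a+1}, …, x_{a+r}` is a recursive summation of `r + 1` values of `φ` with the same
accumulators, error `≤ ru/(1+ru)·(|ŝ_a| + Σ|x_{a+i}|)`, and `|ŝ_a| = |s_a| ≤ L_a`.
[cell; cite: LangeRump2019; BoldoEtAl2023, Thm 4.5] -/
theorem relErr_le_langeRump_exact {a r : ℕ}
    (hexa : (seqSum φ x a).toRat = ∑ i ∈ range (a + 1), x i)
    (hsa : |(seqSum φ x a).toRat| ≤ 2 ^ (φ.manBits + 2) / 2 ^ G) (hr : r ≤ 2 ^ φ.manBits) :
    relErr φ x (a + r) ≤ (r : ℚ) / (2 ^ (φ.manBits + 1) + r) := by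
  classical
  have hGpos : (0 : ℚ) < 2 ^ G := by positivity
  have hTpos : (0 : ℚ) < 2 ^ (φ.manBits + 1) := by positivity
  have hT2 : (2 : ℚ) ^ (φ.manBits + 2) = 2 * 2 ^ (φ.manBits + 1) := by ring
  have hcnn : (0 : ℚ) ≤ (r : ℚ) / (2 ^ (φ.manBits + 1) + r) := by positivity
  have hshift := toRat_seqSum_restartW (φ := φ) x a r
  set w := restartW φ x a with hw
  set sa := (seqSum φ x a).toRat with hsa_def
  set X := ∑ i ∈ range r, |x (a + 1 + i)| with hX
  set Px := ∑ i ∈ range r, x (a + 1 + i) with hPx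
  have hX0 : 0 ≤ X := sum_nonneg fun i _ => abs_nonneg _
  have hsx : ∑ i ∈ range (a + r + 1), x i = sa + Px := by
    rw [show a + r + 1 = (a + 1) + r by ring, sum_range_add, ← hexa]
  have hLx' : ∑ i ∈ range (a + r + 1), |x i| = (∑ i ∈ range (a + 1), |x i|) + X := by
    rw [show a + r + 1 = (a + 1) + r by ring, sum_range_add]
  have hsaL : |sa| ≤ ∑ i ∈ range (a + 1), |x i| := by
    rw [hexa]; exact abs_sum_le_sum_abs _ _
  have hLx : |sa| + X ≤ ∑ i ∈ range (a + r + 1), |x i| := by rw [hLx']; linarith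
  have hsw : ∑ i ∈ range (r + 1), w i = sa + Px := sum_restartW x a r
  have hLw : ∑ i ∈ range (r + 1), |w i| = |sa| + X := sum_abs_restartW x a r
  have hw0 : ∃ y : MiniFloat φ, y.toRat = w 0 := ⟨seqSum φ x a, by rw [hw, restartW_zero]⟩
  have hα : 2 ≤ φ.emaxCode :=
    two_le_emaxCode_of_le (by omega) (le_trans (pow_le_pow_right₀ (by norm_num) (by omega)) hR)
  have hyrep : ∀ i ≤ r, ∃ y : MiniFloat φ, y.toRat = w i := by
    intro i _
    rcases i with _ | i
    · exact hw0
    · rw [hw, restartW_succ]; exact letter_reprG' hx hq hR hMT _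
  have hu : φ.unitRoundoff = 1 / 2 ^ (φ.manBits + 1) := Format.unitRoundoff_eq φ
  have hupos := φ.unitRoundoff_pos
  have hT1 : (2 : ℚ) ^ (φ.manBits + 1) = 2 * 2 ^ φ.manBits := by ring
  have hrq : (r : ℚ) ≤ 2 ^ φ.manBits := by exact_mod_cast hr
  have hku : 2 * (r : ℚ) * φ.unitRoundoff ≤ 1 := by
    rw [hu, hT1]; field_simp; linarith
  have hx' : ∀ j, ∃ z : ℤ, x (a + 1 + j) = (z : ℚ) / 2 ^ G ∧ z.natAbs ≤ M ∧
      (z % 2 = 0 ∨ z.natAbs ≤ m0) := fun j => hx (a + 1 + j)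
  have hXle : X ≤ (M : ℚ) / 2 ^ G * r := sum_abs_leG hx' r
  have hsum : (1 + (r : ℚ) * (φ.unitRoundoff / (1 + φ.unitRoundoff)))
      * ∑ i ∈ range (r + 1), |w i| ≤ φ.maxRat := by
    rw [hLw]
    have hfac : (r : ℚ) * (φ.unitRoundoff / (1 + φ.unitRoundoff)) ≤ 1 / 2 := by
      have h1 : φ.unitRoundoff / (1 + φ.unitRoundoff) ≤ φ.unitRoundoff :=
        div_le_self hupos.le (by linarith)
      calc (r : ℚ) * (φ.unitRoundoff / (1 + φ.unitRoundoff)) ≤ r * φ.unitRoundoff :=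
            mul_le_mul_of_nonneg_left h1 (Nat.cast_nonneg r)
        _ ≤ 1 / 2 := by linarith
    have hMG : (M : ℚ) / 2 ^ G ≤ 2 ^ E := by
      rw [div_le_iff₀ hGpos, ← pow_add, add_comm]
      exact_mod_cast hME
    have hG1 : (1 : ℚ) ≤ 2 ^ G := one_le_pow₀ (by norm_num)
    have hE1 : (1 : ℚ) ≤ 2 ^ E := one_le_pow₀ (by norm_num)
    have hsa2 : |sa| ≤ 2 * 2 ^ (φ.manBits + 1) := by
      refine le_trans hsa ?_
      rw [div_le_iff₀ hGpos, hT2]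
      exact le_mul_of_one_le_right (by positivity) hG1
    have hX2 : X ≤ 2 ^ E * 2 ^ φ.manBits :=
      le_trans hXle (mul_le_mul hMG hrq (Nat.cast_nonneg r) (by positivity))
    have e : (2 : ℚ) ^ (φ.manBits + E + 3) = 4 * (2 ^ E * 2 ^ (φ.manBits + 1)) := by ring
    have e2 : (2 : ℚ) ^ E * 2 ^ (φ.manBits + 1) = 2 * (2 ^ E * 2 ^ φ.manBits) := by ring
    have hpos : 0 ≤ |sa| + X := by positivity
    have hET : (2 : ℚ) ^ (φ.manBits + 1) ≤ 2 ^ E * 2 ^ (φ.manBits + 1) :=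
      le_mul_of_one_le_left hTpos.le hE1
    calc (1 + (r : ℚ) * (φ.unitRoundoff / (1 + φ.unitRoundoff))) * (|sa| + X)
        ≤ (3 / 2) * (|sa| + X) := mul_le_mul_of_nonneg_right (by linarith) hpos
      _ ≤ 2 ^ (φ.manBits + E + 3) := by rw [e]; linarith
      _ ≤ φ.maxRat := hR
  have hLR := abs_seqSum_sub_sum_le_langeRump_of_sum_le hα w r hyrep hsum hku
  have hcoef : (r : ℚ) * φ.unitRoundoff / (1 + (r : ℚ) * φ.unitRoundoff)
      = (r : ℚ) / (2 ^ (φ.manBits + 1) + r) := by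
    rw [hu]; field_simp
  rw [hsw, hLw, hcoef] at hLR
  unfold relErr
  rw [hshift, hsx]
  by_cases hL : ∑ i ∈ range (a + r + 1), |x i| = 0
  · rw [hL, div_zero]; exact hcnn
  have hLpos : 0 < ∑ i ∈ range (a + r + 1), |x i| :=
    lt_of_le_of_ne (sum_nonneg fun i _ => abs_nonneg _) (Ne.symm hL)
  rw [div_le_iff₀ hLpos]
  exact le_trans hLR (mul_le_mul_of_nonneg_left hLx hcnn)

/-- THE EXACT LAW ON THE WHOLE FIRST REGIME `k = d + 1 ≤ T/2 = 2^(manBits φ)`, every grid alphabet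
and precision with `Q ≥ m₀ + 2`: `R(x, j₀+1+d) ≤ max((d+1)/(B+d+1), d/(T+d))` for EVERY word (file
LXIV-c: `Q ≥ M + 2`).  New case: the second argument after the exact prefix is at or above `2T` —
then the entry step was exact and Lange–Rump restarts one letter later. [cell, gemm.tex Prop. p:fpL] -/
theorem relErr_le_firstRegimeLaw_allQ {j0 Bn Q d : ℕ} (hm : 1 ≤ φ.manBits)
    (hj0 : M * j0 + m0 < 2 ^ (φ.manBits + 1))
    (hB : (∑ i ∈ range (j0 + 2), zl G x i) % 2 ≠ 0 →
      2 ^ (φ.manBits + 1) < (∑ i ∈ range (j0 + 2), zl G x i).natAbs →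
      ((Bn : ℚ) + 1) / 2 ^ G ≤ ∑ i ∈ range (j0 + 2), |x i|)
    (hQ : M * (j0 + 2) + Q = 2 * 2 ^ (φ.manBits + 1)) (hQm : m0 + 2 ≤ Q)
    (hd : d + 1 ≤ 2 ^ φ.manBits) :
    relErr φ x (j0 + 1 + d) ≤ max (((d + 1 : ℕ) : ℚ) / ((Bn : ℚ) + ((d + 1 : ℕ) : ℚ)))
      ((d : ℚ) / (2 ^ (φ.manBits + 1) + d)) := by
  classical
  have hGpos : (0 : ℚ) < 2 ^ G := by positivity
  have hmax0 : 0 ≤ max (((d + 1 : ℕ) : ℚ) / ((Bn : ℚ) + ((d + 1 : ℕ) : ℚ)))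
      ((d : ℚ) / (2 ^ (φ.manBits + 1) + d)) :=
    le_trans (by positivity) (le_max_right _ _)
  -- EITHER the word is low up to `j₀ + d` (file LXIII-a) …
  by_cases hex : ∃ j, j0 ≤ j ∧ j < j0 + (d + 1) ∧
      2 ^ (φ.manBits + 2) / 2 ^ G ≤ |(seqSum φ x j).toRat + x (j + 1)|
  swap
  · have hall : ∀ j, j0 ≤ j → j < j0 + (d + 1) →
        |(seqSum φ x j).toRat + x (j + 1)| < 2 ^ (φ.manBits + 2) / 2 ^ G :=
      fun j h1 h2 => lt_of_not_ge fun h => hex ⟨j, h1, h2, h⟩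
    have h := lowInvG_of_low hx hq hR hm0M hMT hj0 hB (d + 1) hall
    rw [show j0 + (d + 1) = j0 + 1 + d by ring] at h
    exact relErr_le_of_lowInvG h
  -- … OR it is high: pass to the integer model `accZ` (the bridge of file LXIV-c)
  obtain ⟨j, hj1, hj2, hj3⟩ := hex
  have hbr := toRat_seqSum_eq_accZ hx hq hR hm0M hMT hME hj0 hQ hd
  have hxz := zl_spec hx
  have hV : ∀ i, i < j0 + 1 + d → (seqSum φ x i).toRat + x (i + 1)
      = ((accZ φ.manBits (zl G x) i + zl G x (i + 1) : ℤ) : ℚ) / 2 ^ G := by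
    intro i hi
    rw [hbr i (by omega), (hxz (i + 1)).1]; push_cast; ring
  have hLsum : ∀ k, (∑ i ∈ range k, (zl G x i).natAbs) ≤ M * k := by
    intro k
    induction k with
    | zero => simp
    | succ k ih => rw [sum_range_succ, Nat.mul_succ]; exact Nat.add_le_add ih (hxz k).2.1
  have hsabs : ∀ k, (∑ i ∈ range (k + 1), zl G x i).natAbs ≤ M * (k + 1) := by
    intro k
    have h1 := abs_sZ_le_LZ (zl G x) k
    unfold sZ LZ at h1
    rw [Int.abs_eq_natAbs, ← Nat.cast_sum] at h1
    have h3 : ((∑ i ∈ range (k + 1), zl G x i).natAbs : ℤ) ≤ ((M * (k + 1) : ℕ) : ℤ) :=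
      le_trans h1 (by exact_mod_cast hLsum (k + 1))
    exact_mod_cast h3
  have hacc : ∀ i, i < j0 + 1 + d → accZ φ.manBits (zl G x) (i + 1)
      = rneZ φ.manBits (accZ φ.manBits (zl G x) i + zl G x (i + 1)) := fun i _ => rfl
  have hpre : accZ φ.manBits (zl G x) j0 = sZ (zl G x) j0 := by
    have h1 := hbr j0 (by omega)
    rw [seqSum_exact_prefixG hx hq hR hm0M hMT hj0 j0 le_rfl, sum_eq_zlG hx j0,
      div_left_inj' (ne_of_gt hGpos)] at h1
    unfold sZ
    exact_mod_cast h1.symm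
  have hs1 : (accZ φ.manBits (zl G x) j0 + zl G x (j0 + 1)).natAbs ≤ M * (j0 + 2) := by
    rw [hpre]; unfold sZ; rw [← sum_range_succ]; exact le_of_le_of_eq (hsabs (j0 + 1)) (by ring)
  have hT2N : 2 ^ (φ.manBits + 2) = 2 * 2 ^ (φ.manBits + 1) := by rw [pow_succ]; ring
  have hV0 : (accZ φ.manBits (zl G x) j0 + zl G x (j0 + 1)).natAbs < 2 ^ (φ.manBits + 2) := by
    omega
  have herr := rneZ_err_le (m := φ.manBits) 0
    (K := accZ φ.manBits (zl G x) j0 + zl G x (j0 + 1)) (by simpa using hV0)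
  rw [← hacc j0 (by omega)] at herr
  simp only [pow_zero] at herr
  -- THE NEW CASE: the second argument at or above `2T` ⟹ the entry step was exact ⟹ Lange–Rump
  -- from the exact accumulator `ŝ_{j₀+1} = s_{j₀+1}`
  by_cases hV1 : (accZ φ.manBits (zl G x) (j0 + 1) + zl G x (j0 + 1 + 1)).natAbs
      < 2 ^ (φ.manBits + 2)
  swap
  · rw [not_lt] at hV1
    -- the entry argument is `s_{j₀+1}` in grid units
    have hVs : accZ φ.manBits (zl G x) j0 + zl G x (j0 + 1)
        = ∑ i ∈ range (j0 + 1 + 1), zl G x i := by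
      rw [hpre]; unfold sZ; rw [sum_range_succ _ (j0 + 1)]
    have hshape := KZ_shapeG hx hm0M (j0 + 1)
    change ((∑ i ∈ range (j0 + 1 + 1), zl G x i) % 2 = 0 ∧
        (∑ i ∈ range (j0 + 1 + 1), zl G x i).natAbs ≤ M * (j0 + 1 + 1)) ∨
      (∑ i ∈ range (j0 + 1 + 1), zl G x i).natAbs ≤ M * (j0 + 1) + m0 at hshape
    rw [← hVs] at hshape
    have hz2 := (hxz (j0 + 1 + 1)).2.1
    have eM2 : M * (j0 + 2) = M * (j0 + 1) + M := by ring
    rcases hshape with ⟨hev, -⟩ | hle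
    swap
    · -- an odd letter was used: the second argument is `≤ M(j₀+2) + m₀ + 1 < 2T`, excluded
      exfalso
      omega
    -- `V` even and `|V| < 2T`: integer RNE to `manBits + 1` bits fixes it
    have hfix : accZ φ.manBits (zl G x) (j0 + 1)
        = accZ φ.manBits (zl G x) j0 + zl G x (j0 + 1) := by
      rw [hacc j0 (by omega)]
      by_cases hlt : (accZ φ.manBits (zl G x) j0 + zl G x (j0 + 1)).natAbs
          < 2 ^ (φ.manBits + 1)
      · exact ThetaLawE2M1.rneZ_of_natAbs_lt hlt
      · obtain ⟨-, hdvd, hdist, -⟩ := rneZ_level (m := φ.manBits) (e := 0)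
          (K := accZ φ.manBits (zl G x) j0 + zl G x (j0 + 1)) (by simpa using not_lt.mp hlt)
          (by simpa using hV0)
        simp only [zero_add, pow_one, pow_zero] at hdvd hdist
        omega
    -- so `ŝ_{j₀+1} = s_{j₀+1}`, of modulus `≤ 2T/2^G`
    have hexa : (seqSum φ x (j0 + 1)).toRat = ∑ i ∈ range (j0 + 1 + 1), x i := by
      rw [hbr (j0 + 1) (by omega), hfix, hVs, sum_eq_zlG hx (j0 + 1)]
    have hsa : |(seqSum φ x (j0 + 1)).toRat| ≤ 2 ^ (φ.manBits + 2) / 2 ^ G := by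
      rw [hbr (j0 + 1) (by omega), hfix, abs_div, abs_of_pos hGpos, ← Int.cast_abs,
        Int.abs_eq_natAbs, Int.cast_natCast]
      apply div_le_div_of_nonneg_right _ hGpos.le
      exact_mod_cast hV0.le
    exact le_trans (relErr_le_langeRump_exact hx hq hR hMT hME hexa hsa (r := d) (by omega))
      (le_max_right _ _)
  -- the spine case of file LXIV-c, verbatim
  have hδ : ∀ i, i < j0 + 1 + d → (accZ φ.manBits (zl G x) (i + 1)
      - (accZ φ.manBits (zl G x) i + zl G x (i + 1))).natAbs ≤ (zl G x (i + 1)).natAbs := by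
    intro i hi
    have h1 := abs_step_err_le_term (φ := φ) x i
    rw [hV i hi, hbr (i + 1) (by omega), (hxz (i + 1)).1, ← sub_div, abs_div, abs_div,
      abs_of_pos hGpos, div_le_div_iff_of_pos_right hGpos] at h1
    apply natAbs_le_of_abs_cast_le
    rw [Nat.cast_natAbs]
    push_cast
    exact_mod_cast h1
  have hhigh : ∃ i, j0 ≤ i ∧ i < j0 + 1 + d ∧
      2 ^ (φ.manBits + 2) ≤ (accZ φ.manBits (zl G x) i + zl G x (i + 1)).natAbs := by
    refine ⟨j, hj1, by omega, le_natAbs_of_cast_le_abs ?_⟩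
    rw [hV j (by omega), abs_div, abs_of_pos hGpos, div_le_div_iff_of_pos_right hGpos] at hj3
    exact_mod_cast hj3
  have hsp := spineZ_abs hm hd hacc hpre hV0 hV1 hδ hhigh
  -- back to `relErr`
  have hq' : ((2 : ℚ) ^ (φ.manBits + 1) + d)
      * |((accZ φ.manBits (zl G x) (j0 + 1 + d) - sZ (zl G x) (j0 + 1 + d) : ℤ) : ℚ)|
      ≤ (d : ℚ) * ((LZ (zl G x) (j0 + 1 + d) : ℤ) : ℚ) := by
    exact_mod_cast hsp
  have e1 : ((LZ (zl G x) (j0 + 1 + d) : ℤ) : ℚ)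
      = ((∑ i ∈ range (j0 + 1 + d + 1), (zl G x i).natAbs : ℕ) : ℚ) := by
    unfold LZ; rw [← Nat.cast_sum, Int.cast_natCast]
  have e2 : ((accZ φ.manBits (zl G x) (j0 + 1 + d) - sZ (zl G x) (j0 + 1 + d) : ℤ) : ℚ)
      = (accZ φ.manBits (zl G x) (j0 + 1 + d) : ℚ)
        - ((∑ i ∈ range (j0 + 1 + d + 1), zl G x i : ℤ) : ℚ) := by
    unfold sZ; push_cast; rfl
  rw [e1, e2] at hq'
  unfold relErr
  rw [hbr (j0 + 1 + d) le_rfl, sum_eq_zlG hx (j0 + 1 + d), sum_abs_eq_natG hx (j0 + 1 + d + 1),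
    ← sub_div, abs_div, abs_of_pos hGpos]
  by_cases hL : ((∑ i ∈ range (j0 + 1 + d + 1), (zl G x i).natAbs : ℕ) : ℚ) = 0
  · rw [hL, zero_div, div_zero]; exact hmax0
  have hLpos : (0 : ℚ) < ((∑ i ∈ range (j0 + 1 + d + 1), (zl G x i).natAbs : ℕ) : ℚ) :=
    lt_of_le_of_ne (Nat.cast_nonneg _) (Ne.symm hL)
  rw [div_div_div_cancel_right₀ (ne_of_gt hGpos)]
  refine le_trans ?_ (le_max_right _ _)
  rw [div_le_iff₀ hLpos, div_mul_eq_mul_div, le_div_iff₀ (by positivity)]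
  linarith

end Grid

/-! ### Rows on the whole first regime under `Q ≥ m₀ + 2` -/

section RowsAllQ

variable {G M m0 E : ℕ} {φ : Format} {L : ℚ → Prop} {W : ℕ → ℚ}
variable
  (hL : ∀ q, L q → ∃ z : ℤ, q = (z : ℚ) / 2 ^ G ∧ z.natAbs ≤ M ∧ (z % 2 = 0 ∨ z.natAbs ≤ m0))
  (hWge : ∀ m, ∃ x : ℕ → ℚ, (∀ j, L (x j)) ∧ W m = relErr φ x m)
  (hq : φ.qexp ≤ -(G : ℤ)) (hR : (2 : ℚ) ^ (φ.manBits + E + 3) ≤ φ.maxRat)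
  (hm0M : m0 ≤ M) (hMT : M ≤ 2 ^ (φ.manBits + 1)) (hm0 : 1 ≤ m0) (hME : M ≤ 2 ^ (G + E))
include hL hWge hq hR hm0M hMT hm0 hME

/-- THE LAW ROW on the whole first regime: `H_B` for every word of the alphabet, `Q ≥ m₀ + 2`,
`k = d + 1 ≤ T/2` give `W(j₀+1+d) ≤ max((d+1)/(B+d+1), d/(T+d))`. [cell, gemm.tex Prop. p:fpL] -/
theorem gridW_le_firstRegimeLaw_allQ {j0 Bn Q d : ℕ} (hm : 1 ≤ φ.manBits)
    (hj0 : M * j0 + m0 < 2 ^ (φ.manBits + 1))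
    (hBall : ∀ x : ℕ → ℚ, (∀ j, L (x j)) → (∑ i ∈ range (j0 + 2), zl G x i) % 2 ≠ 0 →
      2 ^ (φ.manBits + 1) < (∑ i ∈ range (j0 + 2), zl G x i).natAbs →
      ((Bn : ℚ) + 1) / 2 ^ G ≤ ∑ i ∈ range (j0 + 2), |x i|)
    (hQ : M * (j0 + 2) + Q = 2 * 2 ^ (φ.manBits + 1)) (hQm : m0 + 2 ≤ Q)
    (hd : d + 1 ≤ 2 ^ φ.manBits) :
    W (j0 + 1 + d) ≤ max (((d + 1 : ℕ) : ℚ) / ((Bn : ℚ) + ((d + 1 : ℕ) : ℚ)))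
      ((d : ℚ) / (2 ^ (φ.manBits + 1) + d)) := by
  obtain ⟨x, hx, hW⟩ := hWge (j0 + 1 + d)
  rw [hW]
  exact relErr_le_firstRegimeLaw_allQ (fun j => hL _ (hx j)) hq hR hm0M hMT hm0 hME hm hj0
    (hBall x hx) hQ hQm hd

end RowsAllQ

/-! ### E2M1² in every precision `p ≥ 8`; the law for `p ≡ 2 (mod 6)` incl. `p = 8` -/

/-- UPPER HALF for E2M1², EVERY precision `p ≥ 8`, on the whole first regime `k = d+1 ≤ 2^(p-1)`:
with `144 j₀ + 9 < T`, `144(j₀+2) = B + 144`, `B ≤ T + 38`, `144(j₀+2) + Q = 2T` and `Q ≥ 11`: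
`W_φ(j₀+1+d) ≤ max((d+1)/(B+d+1), d/(T+d))`. [cell, gemm.tex Prop. p:fpP (v)] -/
theorem worstP_le_firstRegimeLaw_allQ (hm : 7 ≤ φ.manBits) (hq : φ.qexp ≤ -2)
    (hR : (2 : ℚ) ^ (φ.manBits + 10) ≤ φ.maxRat) {j0 Bn Q d : ℕ}
    (hj0 : 144 * j0 + 9 < 2 ^ (φ.manBits + 1)) (hn : 144 * (j0 + 2) = Bn + 144)
    (hBn : Bn ≤ 2 ^ (φ.manBits + 1) + 38) (hQ : 144 * (j0 + 2) + Q = 2 * 2 ^ (φ.manBits + 1))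
    (hQm : 11 ≤ Q) (hd : d + 1 ≤ 2 ^ φ.manBits) :
    worstRelErrE2M1 φ (j0 + 1 + d) ≤ max (((d + 1 : ℕ) : ℚ) / ((Bn : ℚ) + ((d + 1 : ℕ) : ℚ)))
      ((d : ℚ) / (2 ^ (φ.manBits + 1) + d)) := by
  have hT8 : 256 ≤ 2 ^ (φ.manBits + 1) :=
    le_trans (by norm_num) (Nat.pow_le_pow_right (by norm_num) (by omega : 8 ≤ φ.manBits + 1))
  exact gridW_le_firstRegimeLaw_allQ (L := fun q => q ∈ piE2M1) piE2M1_grid (worstP_specE φ).2 hq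
    (E := 7) hR (by norm_num) (le_trans (by norm_num) hT8) (by norm_num) (by norm_num) (by omega)
    hj0 (fun x hx => e2m1_entryMass hx hn hBn) hQ hQm hd

/-- THE EXACT FIRST-REGIME LAW OF E2M1² for `p ≡ 2 (mod 6)` and EVERY `p ≥ 8` (`144 j₀ + 112 = T`,
`n₀ = j₀ + 1`; `Q = T - 176 ≥ 80`), on the WHOLE first regime:
`W_φ(n₀ + k) = max(k/(T+32+k), (k-1)/(T+k-1))` for every `1 ≤ k ≤ 2^(p-1)` (index `m = j₀+1+d`,
`k = d + 1`; file LXIV-c had `p ≥ 14`). [cell, gemm.tex Prop. p:fpP (v)] -/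
theorem worstP_firstRegimeLaw_two_allQ (hm : 7 ≤ φ.manBits) (hq : φ.qexp ≤ -2)
    (hR : (2 : ℚ) ^ (φ.manBits + 10) ≤ φ.maxRat) {j0 : ℕ}
    (hj0 : 144 * j0 + 112 = 2 ^ (φ.manBits + 1)) {d : ℕ} (hd : d + 1 ≤ 2 ^ φ.manBits) :
    worstRelErrE2M1 φ (j0 + 1 + d)
      = max (((d + 1 : ℕ) : ℚ) / (2 ^ (φ.manBits + 1) + 32 + ((d + 1 : ℕ) : ℚ)))
        ((d : ℚ) / (2 ^ (φ.manBits + 1) + d)) := by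
  have hT8 : 256 ≤ 2 ^ (φ.manBits + 1) :=
    le_trans (by norm_num) (Nat.pow_le_pow_right (by norm_num) (by omega : 8 ≤ φ.manBits + 1))
  obtain ⟨Q, hQ⟩ : ∃ Q, 144 * (j0 + 2) + Q = 2 * 2 ^ (φ.manBits + 1) :=
    ⟨2 * 2 ^ (φ.manBits + 1) - 144 * (j0 + 2), by omega⟩
  have hup := worstP_le_firstRegimeLaw_allQ hm hq hR (j0 := j0) (Bn := 2 ^ (φ.manBits + 1) + 32)
    (d := d) (by omega) (by omega) (by omega) hQ (by omega) hd
  have hpl := le_worstP_plateau hm hq hR (j0 := j0) (by omega) (by omega) (d + 1)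
  have hle := le_worstP_lateEntry hm hq hR (j0 := j0) (C := 64) (D := 48) (by norm_num [piE2M1])
    (by norm_num [piE2M1]) (by omega) (by omega) d
  have e144 : (144 : ℚ) * (j0 + 1) = 2 ^ (φ.manBits + 1) + 32 := by
    exact_mod_cast (show 144 * (j0 + 1) = 2 ^ (φ.manBits + 1) + 32 by omega)
  rw [show j0 + (d + 1) = j0 + 1 + d by ring, e144] at hpl
  push_cast at hup hpl hle ⊢
  exact le_antisymm hup (max_le hpl hle)

/-! ### bfloat16 (`p = 8 ≡ 2 (mod 6)`): `T = 256 = 144 + 112`, `n₀ = 2`, `Q = 80` -/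

/-- THE EXACT WORST CASE OF FP4 (E2M1) PRODUCTS ACCUMULATED SEQUENTIALLY IN bfloat16 (RNE), EVERY
`3 ≤ n ≤ 130`: `W_8(1+k) = max(k/(288+k), (k-1)/(255+k))` for `1 ≤ k ≤ 128` (index `m = 1 + k`,
`n = k + 2`; in `n`: `max((n-2)/(286+n), (n-3)/(253+n))`), attained by `36, 36, ¼^{×k}` (`k ≤ 17`)
resp. `16, 12, 36, ¼^{×(k-1)}` (`k ≥ 17`); the sandwich `worstP_BFloat16_firstRegime` of file LX is
now an equality. [cell, gemm.tex Prop. p:bf16law, Prop. p:sandwich (ii)] -/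
theorem worstP_BFloat16_law {k : ℕ} (hk : 1 ≤ k) (hk' : k ≤ 128) :
    worstRelErrE2M1 Format.BFloat16 (1 + k)
      = max ((k : ℚ) / (288 + k)) (((k : ℚ) - 1) / (255 + k)) := by
  obtain ⟨h1, h2, h3⟩ := BFloat16_first_hyps
  obtain ⟨d, rfl⟩ : ∃ d, k = d + 1 := ⟨k - 1, by omega⟩
  have hd : d + 1 ≤ 2 ^ Format.BFloat16.manBits := hk'
  have h := worstP_firstRegimeLaw_two_allQ h1 h2 h3 (j0 := 1) (by decide) hd
  rw [show Format.BFloat16.manBits + 1 = 8 from rfl, show 1 + 1 + d = 1 + (d + 1) by ring] at h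
  rw [h]
  push_cast
  congr 1
  · rw [div_eq_div_iff (by positivity) (by positivity)]; ring
  · rw [div_eq_div_iff (by positivity) (by positivity)]; ring

end Summit.Ventures.CertifiedArithmetic.LowPrec.Gemm
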